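import Literature.Computability.Cryptography.OneWayFunctions
import Literature.Computability.Cryptography.OracleGames
import Literature.Computability.Cryptography.OracleAdversaryPrecomp
import Literature.Computability.Cryptography.StatisticalDistanceMixtures
import Literature.Computability.Complexity.OracleProofs
import HarnessLib

/-!
# One-way functions relative to an oracle

Topic `Literature/Computability/Cryptography`; companion of `OneWayFunctions.lean` (Goldreich's
strong one-way functions `IsOneWay`, non-uniform one-wayness `IsOneWayNonuniform`, the existence
statements `OWFExist`, `NonuniformOWFExist`) in the RELATIVIZED setting: the candidate function is
computed, and attacked, with access to an oracle `O : Oracle`. This is the vocabulary of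
black-box / oracle results about cryptographic (average-case) one-wayness — "relative to a random
oracle cryptographic one-way functions exist" (Impagliazzo–Rudich, as used by Fortnow–Rogers
1999, §4.1), "is there a relativized world where `BPP = BQP` and cryptographic one-way functions
exist?" (Fortnow–Rogers 1999, §4.1; consumer: `Literature/Barriers/QuantumAdvantage/CryptoOWFCollapseWorld.lean`)
— as opposed to the WORST-CASE relativized one-way functions of Fortnow–Rogers §2.5 / Thm. 4.2
(`P^O ≠ UP^O`, `Literature.Barriers.QuantumAdvantage.UPRel`).

## Contents

* `invertProbRel O f 𝒜 n`, `invertProbAdvRel O f 𝒜 a n` — inversion probability of a C4a oracle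
  adversary `𝒜 : OracleAdversary (List Bool)` (`OracleGames.lean`) with oracle `O`, on Goldreich's
  auxiliary input `(1ⁿ, f x)`, without / with an advice string `a n`; the relativized twins of
  `invertProb` / `invertProbAdv` (same input conventions, same averaging `uniformAvg` over
  `x ← U_n`).
* `IsOneWayRel O f` (`f ∈ FP^O` and negligible success of every PPT oracle inverter),
  `IsOneWayNonuniformRel O f` (… of every PPT oracle inverter with polynomial-length advice),
  `OWFExistRel O`, `NonuniformOWFExistRel O` — the `O`-relativizations of `IsOneWay`,
  `IsOneWayNonuniform`, `OWFExist`, `NonuniformOWFExist`. These are PREDICATES ON ORACLES; nothing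
  is asserted about any particular oracle.
* `IsOneWayNonuniformRel.isOneWayRel`, `NonuniformOWFExistRel.owfExistRel` — advice can be
  ignored (Goldreich Prop. 2.2.7, relativized), by closure of PPT oracle adversaries under
  polynomial-time input preprocessing (`OracleAdversary.exists_ppt_outputPMF_precomp`).
* Sanity anchor `not_isOneWayRel_const`: a constant function is one-way relative to NO oracle —
  the query-free, coin-free `trivialOracleInverter` inverts it with probability `1`
  (`invertProbRel_trivialOracleInverter_eq_one`).

## Design notes

* Inverters are C4a `OracleAdversary (List Bool)` — uniform transcript machines with LITERAL
  polynomial coin and round budgets — with `IsPPT (encodingList Bool)`; the unrelativized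
  `IsOneWay` quantifies over G01 `RandAlg` inverters instead (coin budget only bounded), so no
  bridge `IsOneWayRel Oracle.empty f ↔ IsOneWay f` is stated (compare the `SampPRel_empty`
  discussion in `Literature/Barriers/QuantumAdvantage/SupremacyTheoremsNonRelativizing.lean`).
* Success = the output is `some z` with `f z = f x` (`some '' {z | f z = f x}`); `none` (no output
  within the round budget) is a failure. No honesty clause is needed: the inverter is handed `1ⁿ`
  (Goldreich Def. 2.2.1), unlike the worst-case notion of Fortnow–Rogers §2.5.
* "Nonuniform polynomial-size circuits" as inverters (Fortnow–Rogers §4.1; Goldreich Def. 2.2.6)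
  are rendered by PPT oracle machines with polynomial advice, the inverter receiving
  `boolPair (a n) (boolPair (unaryEncodeNat n) (f x))` exactly as in `invertProbAdv` (Goldreich
  §2.2.5 with §1.3.3; §2.7.4 Exercise 6 for probabilistic circuits) — relative to an oracle, the
  classical equivalent of polynomial-size ORACLE circuits.
* Negligible = Mathlib's `SuperpolynomialDecay atTop (fun n : ℕ => (n : ℝ))`, as in `IsOneWay`.

## References

* O. Goldreich, *Foundations of Cryptography I*, CUP 2001: Def. 2.2.1 (strong one-way functions),
  §2.2.5 with Def. 2.2.6 and Prop. 2.2.7 (non-uniform one-wayness), §1.3.3 (advice), §3.6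
  Def. 3.6.4 (probabilistic polynomial-time oracle machines) — locators as verified for
  `OneWayFunctions.lean` / `OracleGames.lean`.
* L. Fortnow, J. Rogers, *Complexity limitations on quantum computation*, JCSS 59 (1999),
  arXiv:cs/9811023 (read via `lit read arxiv:cs/9811023`): §2.5 (p. 4: worst-case one-way
  functions "may not be suitable for cryptographic purposes which require average-case hardness
  against nonuniform inverters"), §4.1 (p. 7: "cryptographic one-way functions, i.e., functions
  not invertible on a large fraction of inputs with nonuniform polynomial-size circuits").
-/

noncomputable section

namespace Literature.Computability.Cryptography

open Filter Asymptotics _root_.Computability Complexity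

/-! ### Relativized inversion probabilities -/

/-- `invertProbRel O f 𝒜 n`: the probability that the oracle adversary `𝒜` with oracle `O`, given
`(1ⁿ, f x)` (as `boolPair (unaryEncodeNat n) (f x)`), outputs `some z` with `f z = f x`, averaged
over `x ← U_n` and the coins of `𝒜`:
`Pr_{x ← U_n, r}[𝒜^O(1ⁿ, f(x); r) ∈ f⁻¹(f(x))]` — `invertProb` with a PPT oracle machine for the
inverter. [cite: Goldreich2001, Def. 2.2.1 with §3.6 Def. 3.6.4 (oracle machines)] -/
def invertProbRel (O : Oracle) (f : List Bool → List Bool) (𝒜 : OracleAdversary (List Bool))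
    (n : ℕ) : ℝ :=
  uniformAvg n fun x =>
    ((𝒜.outputPMF O (boolPair (unaryEncodeNat n) (f x))).toOuterMeasure
      (some '' {z | f z = f x})).toReal

/-- `invertProbAdvRel O f 𝒜 a n`: inversion probability of the oracle adversary `𝒜` with oracle
`O` and advice string `a n`, i.e. `𝒜` receives `boolPair (a n) (boolPair (unaryEncodeNat n) (f x))`
— `invertProbAdv` with a PPT oracle machine for the inverter.
[cite: Goldreich2001, §2.2.5 Def. 2.2.6 with §1.3.3 (advice) and §3.6 Def. 3.6.4] -/
def invertProbAdvRel (O : Oracle) (f : List Bool → List Bool) (𝒜 : OracleAdversary (List Bool))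
    (a : ℕ → List Bool) (n : ℕ) : ℝ :=
  uniformAvg n fun x =>
    ((𝒜.outputPMF O (boolPair (a n) (boolPair (unaryEncodeNat n) (f x)))).toOuterMeasure
      (some '' {z | f z = f x})).toReal

/-- `invertProbRel O f 𝒜 n` is nonnegative. [cite: Goldreich2001, Def. 2.2.1] -/
theorem invertProbRel_nonneg (O : Oracle) (f : List Bool → List Bool)
    (𝒜 : OracleAdversary (List Bool)) (n : ℕ) : 0 ≤ invertProbRel O f 𝒜 n :=
  uniformAvg_nonneg fun _ => ENNReal.toReal_nonneg

/-- `invertProbRel O f 𝒜 n` is at most `1`. [cite: Goldreich2001, Def. 2.2.1] -/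
theorem invertProbRel_le_one (O : Oracle) (f : List Bool → List Bool)
    (𝒜 : OracleAdversary (List Bool)) (n : ℕ) : invertProbRel O f 𝒜 n ≤ 1 :=
  uniformAvg_le_one fun _ => PMF.toReal_toOuterMeasure_le_one _ _

/-- `invertProbAdvRel O f 𝒜 a n` is nonnegative. [cite: Goldreich2001, Def. 2.2.6] -/
theorem invertProbAdvRel_nonneg (O : Oracle) (f : List Bool → List Bool)
    (𝒜 : OracleAdversary (List Bool)) (a : ℕ → List Bool) (n : ℕ) :
    0 ≤ invertProbAdvRel O f 𝒜 a n :=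
  uniformAvg_nonneg fun _ => ENNReal.toReal_nonneg

/-- `invertProbAdvRel O f 𝒜 a n` is at most `1`. [cite: Goldreich2001, Def. 2.2.6] -/
theorem invertProbAdvRel_le_one (O : Oracle) (f : List Bool → List Bool)
    (𝒜 : OracleAdversary (List Bool)) (a : ℕ → List Bool) (n : ℕ) :
    invertProbAdvRel O f 𝒜 a n ≤ 1 :=
  uniformAvg_le_one fun _ => PMF.toReal_toOuterMeasure_le_one _ _

/-! ### Cryptographic one-way functions relative to an oracle -/

/-- `IsOneWayRel O f`: `f` is a (strong, cryptographic) one-way function RELATIVE TO THE ORACLE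
`O` — `f ∈ FP^O` (computable by a polynomial-time oracle transcript machine, `FPRel O`) and every
probabilistic polynomial-time oracle inverter `𝒜^O` succeeds with negligible probability:
`n ↦ Pr_{x ← U_n}[𝒜^O(1ⁿ, f x) ∈ f⁻¹(f x)]` has superpolynomial decay. The `O`-relativization of
`IsOneWay` (Goldreich's Def. 2.2.1, with oracle machines as in his Def. 3.6.4).
[cite: Goldreich2001, Def. 2.2.1 with §3.6 Def. 3.6.4 (oracle machines)] -/
def IsOneWayRel (O : Oracle) (f : List Bool → List Bool) : Prop :=
  f ∈ FPRel O ∧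
    ∀ 𝒜 : OracleAdversary (List Bool), 𝒜.IsPPT (encodingList Bool) →
      SuperpolynomialDecay atTop (fun n : ℕ => (n : ℝ)) (invertProbRel O f 𝒜)

/-- `IsOneWayNonuniformRel O f`: `f ∈ FP^O` is one-way relative to `O` against NON-UNIFORM
polynomial-time oracle inverters — for every PPT oracle adversary `𝒜` and every polynomial-length
advice sequence `a`, the advised inversion probability `invertProbAdvRel O f 𝒜 a` is negligible.
"Functions not invertible on a large fraction of inputs with nonuniform polynomial-size circuits"
(Fortnow–Rogers §4.1), with polynomial-size (oracle) circuits rendered as PPT (oracle) machines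
with polynomial advice exactly as in `IsOneWayNonuniform` (Goldreich §2.2.5); the
`O`-relativization of `IsOneWayNonuniform`.
[cite: Goldreich2001, §2.2.5 Def. 2.2.6 with §1.3.3] [cite: FortnowRogers1999JCSS, §4.1 (arXiv numbering, p. 7)] -/
def IsOneWayNonuniformRel (O : Oracle) (f : List Bool → List Bool) : Prop :=
  f ∈ FPRel O ∧
    ∀ 𝒜 : OracleAdversary (List Bool), 𝒜.IsPPT (encodingList Bool) →
      ∀ a : ℕ → List Bool, IsPolyLength a →
        SuperpolynomialDecay atTop (fun n : ℕ => (n : ℝ)) (invertProbAdvRel O f 𝒜 a)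

/-- Unfolding of `IsOneWayRel`. [cite: Goldreich2001, Def. 2.2.1] -/
theorem isOneWayRel_iff (O : Oracle) (f : List Bool → List Bool) :
    IsOneWayRel O f ↔ f ∈ FPRel O ∧
      ∀ 𝒜 : OracleAdversary (List Bool), 𝒜.IsPPT (encodingList Bool) →
        SuperpolynomialDecay atTop (fun n : ℕ => (n : ℝ)) (invertProbRel O f 𝒜) :=
  Iff.rfl

/-- Unfolding of `IsOneWayNonuniformRel`. [cite: Goldreich2001, §2.2.5 Def. 2.2.6] -/
theorem isOneWayNonuniformRel_iff (O : Oracle) (f : List Bool → List Bool) :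
    IsOneWayNonuniformRel O f ↔ f ∈ FPRel O ∧
      ∀ 𝒜 : OracleAdversary (List Bool), 𝒜.IsPPT (encodingList Bool) →
        ∀ a : ℕ → List Bool, IsPolyLength a →
          SuperpolynomialDecay atTop (fun n : ℕ => (n : ℝ)) (invertProbAdvRel O f 𝒜 a) :=
  Iff.rfl

/-- A relativized one-way function is in `FP^O`. [cite: Goldreich2001, Def. 2.2.1] -/
theorem IsOneWayRel.mem_FPRel {O : Oracle} {f : List Bool → List Bool} (h : IsOneWayRel O f) :
    f ∈ FPRel O :=
  h.1

/-- A relativized one-way function defeats every PPT oracle inverter. [cite: Goldreich2001, Def. 2.2.1] -/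
theorem IsOneWayRel.superpolynomialDecay {O : Oracle} {f : List Bool → List Bool}
    (h : IsOneWayRel O f) {𝒜 : OracleAdversary (List Bool)} (h𝒜 : 𝒜.IsPPT (encodingList Bool)) :
    SuperpolynomialDecay atTop (fun n : ℕ => (n : ℝ)) (invertProbRel O f 𝒜) :=
  h.2 𝒜 h𝒜

/-- A non-uniformly secure relativized one-way function is in `FP^O`. [cite: Goldreich2001, §2.2.5 Def. 2.2.6] -/
theorem IsOneWayNonuniformRel.mem_FPRel {O : Oracle} {f : List Bool → List Bool}
    (h : IsOneWayNonuniformRel O f) : f ∈ FPRel O :=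
  h.1

/-- With the empty advice `a n = []`, an adversary that first strips the advice component
(`Brick.sndF`) has the plain inversion probability. [folklore] -/
theorem invertProbAdvRel_nil_eq {O : Oracle} {f : List Bool → List Bool}
    {𝒜 𝒜' : OracleAdversary (List Bool)}
    (hout : ∀ (O' : Oracle) (w : List Bool), 𝒜'.outputPMF O' w = 𝒜.outputPMF O' (Brick.sndF w)) :
    invertProbAdvRel O f 𝒜' (fun _ => []) = invertProbRel O f 𝒜 := by
  funext n
  unfold invertProbAdvRel invertProbRel
  congr 1
  funext x
  rw [hout, Brick.sndF_boolPair]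

/-- **Non-uniform one-wayness implies one-wayness, relative to every oracle** (Goldreich,
Prop. 2.2.7, direction "non-uniform ⟹ uniform", relativized): a uniform PPT oracle inverter is an
advised one that ignores its (empty) advice — by closure of PPT oracle adversaries under
polynomial-time input preprocessing (`OracleAdversary.exists_ppt_outputPMF_precomp` with the
projection `Brick.sndF`). [cite: Goldreich2001, Prop. 2.2.7 (§2.2.5)] -/
theorem IsOneWayNonuniformRel.isOneWayRel {O : Oracle} {f : List Bool → List Bool}
    (h : IsOneWayNonuniformRel O f) : IsOneWayRel O f := by
  refine ⟨h.1, fun 𝒜 h𝒜 => ?_⟩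
  obtain ⟨𝒜', h𝒜', hout⟩ :=
    𝒜.exists_ppt_outputPMF_precomp h𝒜 (g := Brick.sndF) Brick.sndF_mem_FP
  have hadv : IsPolyLength (fun _ : ℕ => ([] : List Bool)) := ⟨0, fun n => by simp⟩
  rw [← invertProbAdvRel_nil_eq (O := O) (f := f) hout]
  exact h.2 𝒜' h𝒜' _ hadv

/-! ### Sanity: constant functions are one-way relative to no oracle -/

/-- The trivial inverter: query-free, coin-free, one round, always outputs the empty string.
[folklore] -/
def trivialOracleInverter : OracleAdversary (List Bool) where
  alg := OracleAlg.ofFun fun _ => []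
  coins := 0
  fuel := 1

/-- The trivial inverter is PPT (`OracleAlg.isPolyTime_ofFun_holds`, `const_mem_FP`). [folklore] -/
theorem trivialOracleInverter_isPPT : trivialOracleInverter.IsPPT (encodingList Bool) :=
  OracleAlg.isPolyTime_ofFun_holds (const_mem_FP [])

/-- Its output law is the Dirac mass at `some []`, whatever the oracle and the input. [folklore] -/
theorem outputPMF_trivialOracleInverter (O : Oracle) (w : List Bool) :
    trivialOracleInverter.outputPMF O w = PMF.pure (some []) := by
  rw [OracleAdversary.outputPMF_eq_map]
  have hrun : ∀ r : List.Vector Bool (trivialOracleInverter.coins.eval w.length),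
      trivialOracleInverter.alg.run O (trivialOracleInverter.fuel.eval w.length)
        (boolPair w r.toList) = some [] := fun r => by
    simp only [trivialOracleInverter, Polynomial.eval_one]
    rfl
  simp only [hrun]
  exact PMF.map_const _ _

/-- The trivial inverter lands in any event containing `some []` with probability `1`. [folklore] -/
theorem toReal_toOuterMeasure_outputPMF_trivialOracleInverter (O : Oracle) (w : List Bool)
    {S : Set (Option (List Bool))} (hS : some [] ∈ S) :
    ((trivialOracleInverter.outputPMF O w).toOuterMeasure S).toReal = 1 := by
  rw [outputPMF_trivialOracleInverter, PMF.toOuterMeasure_pure_apply, if_pos hS,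
    ENNReal.toReal_one]

/-- Against a function taking at `[]` the value it takes everywhere on `{0,1}ⁿ` — in particular a
constant function — the trivial inverter always succeeds at security parameter `n`:
`invertProbRel O f trivialOracleInverter n = 1`. [folklore] -/
theorem invertProbRel_trivialOracleInverter_eq_one (O : Oracle) {f : List Bool → List Bool}
    (n : ℕ) (hf : ∀ x : List Bool, x.length = n → f [] = f x) :
    invertProbRel O f trivialOracleInverter n = 1 := by
  unfold invertProbRel uniformAvg
  have hsum : ∀ v : List.Vector Bool n,
      ((trivialOracleInverter.outputPMF O (boolPair (unaryEncodeNat n) (f v.toList))).toOuterMeasure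
        (some '' {z | f z = f v.toList})).toReal = 1 := fun v =>
    toReal_toOuterMeasure_outputPMF_trivialOracleInverter O _
      ⟨[], hf v.toList v.toList_length, rfl⟩
  simp only [hsum]
  rw [Finset.sum_const, Finset.card_univ, card_vector, Fintype.card_bool, nsmul_eq_mul]
  push_cast
  field_simp

/-- The constant function `1` does not decay superpolynomially against `n ↦ n`. [folklore] -/
private theorem not_superpolynomialDecay_one :
    ¬ SuperpolynomialDecay atTop (fun n : ℕ => (n : ℝ)) (fun _ => (1 : ℝ)) := by
  intro h
  have h1 := h 1
  simp only [pow_one, mul_one] at h1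
  exact tendsto_natCast_atTop_atTop.not_tendsto (disjoint_nhds_atTop (0 : ℝ)).symm h1

/-- **Sanity anchor**: a constant function is one-way relative to NO oracle (the trivial inverter
inverts it with probability `1`), so `IsOneWayRel O` — hence `OWFExistRel O` below — is not
vacuously satisfiable. [cite: Goldreich2001, Def. 2.2.1] -/
theorem not_isOneWayRel_const (O : Oracle) (c : List Bool) : ¬ IsOneWayRel O fun _ => c := by
  intro h
  have hdec := h.superpolynomialDecay trivialOracleInverter_isPPT
  rw [show invertProbRel O (fun _ => c) trivialOracleInverter = fun _ => 1 from
    funext fun n => invertProbRel_trivialOracleInverter_eq_one O n fun _ _ => rfl] at hdec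
  exact not_superpolynomialDecay_one hdec

/-- Likewise for the nonuniform notion. [cite: Goldreich2001, Def. 2.2.6] -/
theorem not_isOneWayNonuniformRel_const (O : Oracle) (c : List Bool) :
    ¬ IsOneWayNonuniformRel O fun _ => c :=
  fun h => not_isOneWayRel_const O c h.isOneWayRel

/-! ### Existence predicates -/

/-- `OWFExistRel O`: **cryptographic one-way functions exist relative to `O`** —
`∃ f, IsOneWayRel O f` (so `f ∈ FP^O`, secure against uniform PPT oracle inverters); the
`O`-relativization of `OWFExist`. A predicate on oracles: nothing is asserted here about any
particular `O`. [cite: Goldreich2001, Def. 2.2.1 with §3.6 Def. 3.6.4 (oracle machines)] -/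
def OWFExistRel (O : Oracle) : Prop :=
  ∃ f : List Bool → List Bool, IsOneWayRel O f

/-- `NonuniformOWFExistRel O`: cryptographic one-way functions secure against NON-UNIFORM
inverters exist relative to `O` — `∃ f, IsOneWayNonuniformRel O f`; Fortnow–Rogers' "cryptographic
one-way functions" of §4.1, relativized; the `O`-relativization of `NonuniformOWFExist`.
[cite: FortnowRogers1999JCSS, §4.1 (arXiv numbering, p. 7)] [cite: Goldreich2001, §2.2.5 Def. 2.2.6] -/
def NonuniformOWFExistRel (O : Oracle) : Prop :=
  ∃ f : List Bool → List Bool, IsOneWayNonuniformRel O f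

/-- Relative to every oracle, non-uniformly secure one-way functions are one-way functions.
[cite: Goldreich2001, Prop. 2.2.7 (§2.2.5)] -/
theorem NonuniformOWFExistRel.owfExistRel {O : Oracle} (h : NonuniformOWFExistRel O) :
    OWFExistRel O :=
  let ⟨f, hf⟩ := h
  ⟨f, hf.isOneWayRel⟩

/-- A witness of `OWFExistRel O` is not a constant function. [cite: Goldreich2001, Def. 2.2.1] -/
theorem OWFExistRel.exists_ne {O : Oracle} (h : OWFExistRel O) :
    ∃ f : List Bool → List Bool, IsOneWayRel O f ∧ ∀ c, f ≠ fun _ => c :=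
  let ⟨f, hf⟩ := h
  ⟨f, hf, fun c hc => not_isOneWayRel_const O c (hc ▸ hf)⟩

end Literature.Computability.Cryptography

end
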